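import Summits.HodgeConjecture.HodgeConjecture.Theses.LinearSystemTorelli
import Literature.AlgebraicGeometry.HodgeTheory.ClassesSupportedOn
import Literature.AlgebraicGeometry.HodgeTheory.SupportedHodgeClassesAlgebraic
import Literature.AlgebraicGeometry.HodgeTheory.GysinKernelProofs
import Literature.AlgebraicGeometry.HodgeTheory.HodgeClassesCupPairing
import Literature.AlgebraicGeometry.HodgeTheory.HodgeTypePullback
import Literature.AlgebraicGeometry.HodgeTheory.ComplexConjugationHolds
import Literature.AlgebraicGeometry.Resolution.ProjectiveResolutionProofs
import Literature.AlgebraicGeometry.Motives.ComplexPointsOrientation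
import Summits.HodgeConjecture.HodgeConjecture.Theorems.EndoscopicMiddleDegreeIsotypicMiddleClassesAlgebraicStubTopGysinInjective

/-!
# Route `LinearSystemTorelli` — crux `MiddleDivisorSupportFourfold` (stmt-HodgeConjecture-2409), line `Sketch`: stub `ThreefoldDetection`

Helper file for the crux item stmt-HodgeConjecture-2409 (route `LinearSystemTorelli`), serving the
registered stub `stub_threefoldDetection : ThreefoldDetection` of the line skeleton
`Cruxes/MiddleDivisorSupportFourfold/Lines/Sketch.lean` — de Cataldo–Migliorini, *On singularities
of primitive cohomology classes* (PAMS 137 (2009) = arXiv:0711.1307), §4, last paragraph, with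
`n = 2`: on a smooth projective complex fourfold `X`, a rational `(2,2)`-class `c ∈ H⁴(X(ℂ); ℂ)`
that pairs non-trivially (cup product into `H⁸(X(ℂ); ℂ)`) with a class supported on a divisor
`Z ⊊ X` (`a ∈ classesSupportedOn X Z 4 = ker (H⁴(X(ℂ)) → H⁴((X ∖ Z)(ℂ)))`) pairs non-trivially with
an algebraic surface class (`∈ supportedClasses X 4 2 = Alg²(X)`).

What is PROVED here (no `sorry`, no new definition, no new named fact):

* `threefoldDetection_map_eq_zero_of_forall_cupProduct_eq_zero` — the THREEFOLD STEP: if `c` is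
  cup-orthogonal to `Alg²(X)`, then `g^* c = 0` for every morphism `g : Y ⟶ X` from a smooth
  projective threefold `Y`; conditional on BFNP (6.1) for threefolds
  (`hodgeClasses_cupPairing_nondegenerate 3 Y`) and Lefschetz `(1,1)` (`lefschetzOneOne_rational`).
* `threefoldDetection_cupProduct_complexGysin_eq_zero` — hence `c ∪ g_* y = 0` for every Gysin
  summand `g_* y`, `g : Y ⟶ X` from a smooth projective `Y` of dimension `≤ 3` (threefolds by the
  projection formula and the threefold step; surfaces because `g_*(H⁰(Y(ℂ))) ⊆ Alg²(X)`; curves and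
  points contribute nothing to `H⁴`).
* `linearSystemTorelli_middleDivisorSupportFourfold_threefoldDetection_of` — the stub's unfolded
  statement VERBATIM, conditional on THREE named facts of the tree taken by name:
  `Deligne1974_ker_restrictCompl_eq_iSup_range_complexGysin` (Deligne, Hodge III, Cor. 8.2.8:
  `ker (H⁴(X) → H⁴(X ∖ Z)) = Σⱼ im (gⱼ)_*` for a desingularisation `⊔ Yⱼ → Z` of the components),
  `∀ Y, hodgeClasses_cupPairing_nondegenerate 3 Y` (Brosnan–Fang–Nie–Pearlstein (6.1) on smooth
  projective threefolds: a non-zero rational `(2,2)`-class has a rational `(1,1)` cup-partner) and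
  `lefschetzOneOne_rational` (rational `(1,1)`-classes are divisor classes).

Proof (dCM §4, "the class … restricted to a general hyperplane section of a desingularisation of
a component of the divisor is non-zero, hence pairs with an algebraic class by hard Lefschetz,
Lefschetz (1,1) and Hodge index"; here in the cohomological form forced by the tree's carriers).
Suppose `c ∪ a' = 0` for all `a' ∈ Alg²(X)`; we show `c ∪ a = 0` for every `a` supported on `Z`.
Desingularise the components of `Z` (`exists_family_iUnion_range_eq_of_isClosed`, fed with the
THEOREM `Resolution.Hironaka1964_projective_holds`): `Z = ⋃ⱼ gⱼ(Yⱼ)`, `Yⱼ` smooth projective of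
dimension `mⱼ ≤ 3` (all points of `Z` have codimension `≥ 1`). By Deligne 8.2.8,
`a = Σⱼ (gⱼ)_* bⱼ` with `bⱼ ∈ H^{2mⱼ-4}(Yⱼ(ℂ); ℂ)` (Gysin morphisms `complexGysin μ` of the tree for an
orientation family `μ`, which exists — `ComplexPoints.isOrientableOver` — and satisfies Poincaré
duality — `OrientationFamily.hasPoincareDuality`, a theorem). Surfaces (`mⱼ = 2`): `(gⱼ)_* bⱼ`,
`bⱼ ∈ H⁰ = N⁰H⁰`, lies in `N²H⁴(X) = Alg²(X)` (`complexGysin_mem_supportedClasses`, from the proved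
support fact `gysinMap_restrictCompl_eq_zero_of_field ℂ`), so `c ∪ (gⱼ)_* bⱼ = 0`. Threefolds
(`mⱼ = 3`, `bⱼ ∈ H²`): by the projection formula (`complexGysin_cup`)
`c ∪ (gⱼ)_* bⱼ = (gⱼ)_* (gⱼ^* c ∪ bⱼ)`, and `gⱼ^* c = 0`: it is a rational (`IsRationalClass.pullback`)
`(2,2)`-class (`IsOfHodgeType.map_of_le`, Hodge models exist: `nonempty_hodgeModel_holds`) on the
threefold `Yⱼ`; were it non-zero, (6.1) on `Yⱼ` would give a rational `(1,1)`-class `s` with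
`gⱼ^* c ∪ s ≠ 0 ∈ H⁶(Yⱼ(ℂ))`; `s` is a divisor class (Lefschetz (1,1)), so `(gⱼ)_* s ∈ Alg²(X)` and
`0 = c ∪ (gⱼ)_* s = (gⱼ)_* (gⱼ^* c ∪ s)`, whence `gⱼ^* c ∪ s = 0` because the top-degree Gysin map
`H⁶(Yⱼ(ℂ)) → H⁸(X(ℂ))` is injective (`stub_topGysinInjective`, proved in the tree) — contradiction.

Status of the three facts (2026-08-16): none has a `_holds`. Deligne 8.2.8 is reduced in the tree
to its homological core / to Prop. 8.2.7 for singular `Z` (`GysinKernelProofs`, `GysinKernelSplit`,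
`GysinKernelWeights`: mixed Hodge theory); (6.1) to a hard Lefschetz datum with the Hodge–Riemann
anisotropy (`HodgeClassesCupPairingOfHodgeRiemann`); Lefschetz (1,1) to Serre's GAGA for line
bundles (`LefschetzOneOneOfGAGA`). Every other input is a theorem of the tree. Neither `Z ≠ X` nor
`c ≠ 0` is needed as an extra hypothesis (the codimension hypothesis bounds `dim Yⱼ ≤ 3`; the
pairing hypothesis is only used through its negation).
-/

noncomputable section

namespace Summit.HodgeConjecture.HodgeConjecture.Theorems

open CategoryTheory
open Literature.AlgebraicGeometry Literature.AlgebraicGeometry.HodgeTheory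
open Literature.AlgebraicGeometry.Motives
open Literature.AlgebraicTopology.SingularHomology

/-! ### The threefold step -/

/-- **The threefold step of de Cataldo–Migliorini §4 (`n = 2`).** Let `X` be a smooth projective
complex fourfold, `c ∈ H⁴(X(ℂ); ℂ)` a rational `(2,2)`-class which is cup-orthogonal to
`Alg²(X) = supportedClasses X 4 2`, and `g : Y ⟶ X` a morphism from a smooth projective threefold.
Then `g^* c = 0` in `H⁴(Y(ℂ); ℂ)` — granted BFNP (6.1) on threefolds (`hP`) and Lefschetz `(1,1)`
(`hL`): `g^* c` is a rational `(2,2)`-class on `Y` (`IsRationalClass.pullback`,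
`IsOfHodgeType.map_of_le` with a Hodge model of `Y`, `nonempty_hodgeModel_holds`); if it were
non-zero, (6.1) would give a rational `(1,1)`-class `s` on `Y` with `g^* c ∪ s ≠ 0 ∈ H⁶(Y(ℂ); ℂ)`;
but `s` is a divisor class (`hL`), so `g_* s ∈ Alg²(X)` (`complexGysin_mem_supportedClasses`, Gysin
maps preserve supports) and `0 = c ∪ g_* s = g_* (g^* c ∪ s)` (projection formula
`complexGysin_cup`), whence `g^* c ∪ s = 0` by injectivity of the top-degree Gysin map
`H⁶(Y(ℂ)) → H⁸(X(ℂ))` (`stub_topGysinInjective`). The Gysin maps are those of any orientation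
family (`ComplexPoints.isOrientableOver`; Poincaré duality `OrientationFamily.hasPoincareDuality`).
[cite: DecataldoMigliorini2009, §4] [cite: BrosnanFangNiePearlstein2009, §6 (6.1)]
[cite: FultonYoungTableaux1997, Appendix B §B.1 (6)] -/
theorem threefoldDetection_map_eq_zero_of_forall_cupProduct_eq_zero
    (hP : ∀ Y : SchemeOver ℂ, hodgeClasses_cupPairing_nondegenerate 3 Y)
    (hL : lefschetzOneOne_rational) {Y X : SchemeOver ℂ}
    (hY : IsSmoothProjective 3 Y) (hX : IsSmoothProjective 4 X) (g : Y ⟶ X)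
    {c : complexBetti X 4} (hc : IsRationalClass c) (hh : IsOfHodgeType 4 X 4 2 2 c)
    (hno : ∀ a ∈ supportedClasses X 4 2, cupProduct (rfl : (4:ℕ) + 4 = 4 + 4) c a = 0) :
    complexBetti.map g 4 c = 0 := by
  -- an orientation family, with Poincaré duality
  let μ : OrientationFamily := fun _ _ h ↦ (ComplexPoints.isOrientableOver ℂ h).some
  have hμ : μ.HasPoincareDuality := μ.hasPoincareDuality
  -- `g^* c` is a rational `(2,2)`-class on the threefold `Y`
  have htQ : IsRationalClass (complexBetti.map g 4 c) := hc.pullback _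
  have htH : IsOfHodgeType 3 Y 4 2 2 (complexBetti.map g 4 c) :=
    hh.map_of_le hY hX (nonempty_hodgeModel_holds.nonempty hY).some g (by norm_num)
  by_contra hne
  -- BFNP (6.1) on `Y` (`k = 2`, `l = 1`): a rational `(1,1)` partner `s`
  obtain ⟨s, hsQ, hsH, hts⟩ := hP Y hY 6 (show (2:ℕ) + 1 = 3 from rfl)
    (show 2 * 2 + 2 * 1 = 6 by norm_num) _ htQ htH hne
  -- Lefschetz (1,1): `s` is a divisor class, so `g_* s ∈ Alg²(X)` is orthogonal to `c`
  have hsA : s ∈ algebraicClasses Y 1 := hL hY s hsQ hsH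
  have hgs : complexGysin μ hY hX g (show 2 + 2 * 4 = 4 + 2 * 3 by norm_num) s ∈
      supportedClasses X 4 2 :=
    complexGysin_mem_supportedClasses (gysinMap_restrictCompl_eq_zero_of_field ℂ) μ hμ hY hX g _
      (r := 1) (s := 2) (by norm_num) hsA
  -- projection formula: `g_* (g^* c ∪ s) = c ∪ g_* s = 0`
  have h1 : complexGysin μ hY hX g (show 6 + 2 * 4 = 4 + 4 + 2 * 3 by norm_num)
      (cupProduct (show 4 + 2 = 6 by norm_num) (complexBetti.map g 4 c) s) = 0 := by
    rw [complexGysin_cup hμ hY hX g (show 4 + 2 = 6 by norm_num)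
      (show 6 + 2 * 4 = 4 + 4 + 2 * 3 by norm_num) (show 2 + 2 * 4 = 4 + 2 * 3 by norm_num)
      (rfl : (4:ℕ) + 4 = 4 + 4) c s]
    exact hno _ hgs
  -- the top-degree Gysin map `H⁶(Y(ℂ)) → H⁸(X(ℂ))` is injective
  exact hts (stub_topGysinInjective μ hμ hY hX g (show 6 + 2 * 4 = 4 + 4 + 2 * 3 by norm_num) rfl
    (h1.trans (map_zero _).symm))

/-! ### Every Gysin summand from a variety of dimension `≤ 3` is orthogonal to `c` -/

/-- **Gysin summands are cup-orthogonal to an `Alg²`-orthogonal rational `(2,2)`-class.** Let `X`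
be a smooth projective complex fourfold, `c ∈ H⁴(X(ℂ); ℂ)` rational of type `(2,2)` and
cup-orthogonal to `Alg²(X)`, `g : Y ⟶ X` a morphism from a smooth projective `Y` of dimension
`m ≤ 3`, `μ` an orientation family and `y ∈ Hᵃ(Y(ℂ); ℂ)`, `a + 8 = 4 + 2m`. Then
`c ∪ g_* y = 0 ∈ H⁸(X(ℂ); ℂ)`. For `m = 3` (`a = 2`): `c ∪ g_* y = g_* (g^* c ∪ y)` (projection
formula, `complexGysin_cup`) and `g^* c = 0`
(`threefoldDetection_map_eq_zero_of_forall_cupProduct_eq_zero`, facts `hP`, `hL`); for `m = 2`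
(`a = 0`): `g_*(H⁰(Y(ℂ))) = g_*(N⁰H⁰) ⊆ N²H⁴(X) = Alg²(X)` (`complexGysin_mem_supportedClasses`, the
classes of the surfaces `g(Y)`), to which `c` is orthogonal; `m ≤ 1` does not occur.
[cite: DecataldoMigliorini2009, §4] [cite: FultonYoungTableaux1997, Appendix B §B.1 (6)] -/
theorem threefoldDetection_cupProduct_complexGysin_eq_zero
    (hP : ∀ Y : SchemeOver ℂ, hodgeClasses_cupPairing_nondegenerate 3 Y)
    (hL : lefschetzOneOne_rational) (μ : OrientationFamily) {m : ℕ} {Y X : SchemeOver ℂ}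
    (hY : IsSmoothProjective m Y) (hX : IsSmoothProjective 4 X) (g : Y ⟶ X) (hm : m + 1 ≤ 4)
    {a : ℕ} (hab : a + 2 * 4 = 4 + 2 * m)
    {c : complexBetti X 4} (hc : IsRationalClass c) (hh : IsOfHodgeType 4 X 4 2 2 c)
    (hno : ∀ a ∈ supportedClasses X 4 2, cupProduct (rfl : (4:ℕ) + 4 = 4 + 4) c a = 0)
    (y : complexBetti Y a) :
    cupProduct (rfl : (4:ℕ) + 4 = 4 + 4) c (complexGysin μ hY hX g hab y) = 0 := by
  obtain rfl | rfl : m = 3 ∨ m = 2 := by omega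
  · -- threefolds: projection formula and the threefold step
    obtain rfl : a = 2 := by omega
    rw [← complexGysin_cup μ.hasPoincareDuality hY hX g (show 4 + 2 = 6 by norm_num)
      (show 6 + 2 * 4 = 4 + 4 + 2 * 3 by norm_num) hab (rfl : (4:ℕ) + 4 = 4 + 4) c y,
      threefoldDetection_map_eq_zero_of_forall_cupProduct_eq_zero hP hL hY hX g hc hh hno,
      LinearMap.map_zero₂, map_zero]
  · -- surfaces: `g_* y ∈ Alg²(X)`
    obtain rfl : a = 0 := by omega
    refine hno _ (complexGysin_mem_supportedClasses (gysinMap_restrictCompl_eq_zero_of_field ℂ) μ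
      μ.hasPoincareDuality hY hX g hab (r := 0) (s := 2) (by norm_num) ?_)
    rw [supportedClasses_zero]
    exact Submodule.mem_top

/-! ### The stub, conditional on Deligne 8.2.8, BFNP (6.1) for threefolds and Lefschetz (1,1) -/

/-- **Stub `ThreefoldDetection` of line `Sketch` for the crux `MiddleDivisorSupportFourfold`
(stmt-HodgeConjecture-2409), conditional form** — de Cataldo–Migliorini arXiv:0711.1307 = PAMS 137
(2009), §4 (last paragraph, `n = 2`): on a smooth projective complex fourfold `X`, a rational
`(2,2)`-class `c` pairing non-trivially with some class supported on a Zariski-closed `Z` all of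
whose points have codimension `≥ 1` (`a ∈ classesSupportedOn X Z 4`, `c ∪ a ≠ 0 ∈ H⁸(X(ℂ); ℂ)`)
pairs non-trivially with some class of `Alg²(X) = supportedClasses X 4 2`. The body is VERBATIM
the skeleton's `ThreefoldDetection`; the hypotheses are the tree's named facts
`Deligne1974_ker_restrictCompl_eq_iSup_range_complexGysin` (Hodge III Cor. 8.2.8), BFNP (6.1) for
smooth projective threefolds (`hodgeClasses_cupPairing_nondegenerate 3 Y` for all `Y`) and
`lefschetzOneOne_rational`. Proof: contrapositively, if `c ⊥ Alg²(X)` then `c ∪ a = 0` for every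
`a` supported on `Z`: desingularise the components of `Z` (`exists_family_iUnion_range_eq_of_isClosed`
with the theorem `Resolution.Hironaka1964_projective_holds`; `dim Yⱼ ≤ 3`), write
`a = Σⱼ (gⱼ)_* bⱼ` (Deligne 8.2.8, for the orientation family of `ComplexPoints.isOrientableOver`,
Poincaré duality being `OrientationFamily.hasPoincareDuality`), and kill each summand with
`threefoldDetection_cupProduct_complexGysin_eq_zero`.
[cite: DecataldoMigliorini2009, §4] [cite: DeligneHodgeIII1974, Cor. 8.2.8]
[cite: BrosnanFangNiePearlstein2009, §6 (6.1)] [cite: VoisinHodgeI2002, Thm. 11.30] -/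
theorem linearSystemTorelli_middleDivisorSupportFourfold_threefoldDetection_of
    (hA : Deligne1974_ker_restrictCompl_eq_iSup_range_complexGysin)
    (hP : ∀ Y : Literature.AlgebraicGeometry.Motives.SchemeOver ℂ,
      hodgeClasses_cupPairing_nondegenerate 3 Y)
    (hL : lefschetzOneOne_rational) :
    ∀ ⦃X : Literature.AlgebraicGeometry.Motives.SchemeOver ℂ⦄,
      Literature.AlgebraicGeometry.Motives.IsSmoothProjective 4 X →
      ∀ (Z : Set X.left), IsClosed Z → (∀ z ∈ Z, (1 : ℕ∞) ≤ Order.coheight z) →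
        ∀ c : Literature.AlgebraicGeometry.HodgeTheory.complexBetti X 4,
          Literature.AlgebraicGeometry.HodgeTheory.IsRationalClass c →
          Literature.AlgebraicGeometry.HodgeTheory.IsOfHodgeType 4 X 4 2 2 c →
          (∃ a ∈ Literature.AlgebraicGeometry.HodgeTheory.classesSupportedOn X Z 4,
              Literature.AlgebraicTopology.SingularHomology.cupProduct (rfl : (4:ℕ) + 4 = 4 + 4) c a ≠ 0) →
          ∃ a ∈ Literature.AlgebraicGeometry.HodgeTheory.supportedClasses X 4 2,
            Literature.AlgebraicTopology.SingularHomology.cupProduct (rfl : (4:ℕ) + 4 = 4 + 4) c a ≠ 0 := by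
  intro X hX Z hZ hcod c hc hh hvis
  obtain ⟨a, ha, hca⟩ := hvis
  by_contra hno
  push Not at hno
  -- desingularise the components of `Z` (Hironaka): `Z = ⋃ j, g_j(Y j)`, `dim Y j ≤ 3`
  obtain ⟨ι, hι, m, Y, hY, g, hZg, hm⟩ :=
    exists_family_iUnion_range_eq_of_isClosed Resolution.Hironaka1964_projective_holds hX hZ
      (r := 1) hcod
  haveI := hι
  subst hZg
  -- an orientation family (Poincaré duality is a theorem of the tree)
  let μ : OrientationFamily := fun _ _ h ↦ (ComplexPoints.isOrientableOver ℂ h).some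
  -- Deligne 8.2.8: `a` is a sum of Gysin images from the `Y j`
  have ha' := Deligne1974_ker_restrictCompl_eq_iSup_range_complexGysin.mem_iSup_range hA μ
    μ.hasPoincareDuality hX hY g (mem_classesSupportedOn_iff.mp ha)
  -- every Gysin summand is cup-orthogonal to `c`
  have hle : (⨆ (j : ι) (a' : ℕ) (hab : a' + 2 * 4 = 4 + 2 * m j),
      LinearMap.range (complexGysin μ (hY j) hX (g j) hab)) ≤
        LinearMap.ker (cupProduct (rfl : (4:ℕ) + 4 = 4 + 4) c) := by
    refine iSup_le fun j ↦ iSup_le fun a' ↦ iSup_le fun hab ↦ ?_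
    rintro _ ⟨y, rfl⟩
    exact LinearMap.mem_ker.mpr (threefoldDetection_cupProduct_complexGysin_eq_zero hP hL μ (hY j)
      hX (g j) (hm j) hab hc hh hno y)
  exact hca (LinearMap.mem_ker.mp (hle ha'))

end Summit.HodgeConjecture.HodgeConjecture.Theorems

end
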